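import Mathlib
import HarnessLib
import Literature.MathematicalPhysics.StatisticalMechanics.WeightDominatingMultipliers
import Literature.MathematicalPhysics.StatisticalMechanics.GaussianWeightStepMonotoneCov

/-!
# The integration property (w7) of the weight tower against the TRUE step covariance
# (Adams–Buchholz–Kotecký–Müller, Lemma 7.7 (ii) / Theorem 7.1 (w7), margin from (7.42)–(7.45))

`GaussianWeightStepMonotoneCov.integral_weight_add_le_of_cov_le` proves the shape of
Theorem 7.1 (w7) — `∫ w_k^X(φ+ψ) N(0,C')(dψ) ≤ (1−θ)^{−tr(√C' A_k^X √C')/(2θ)} w_{k:k+1}^X(φ)` —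
for any covariance `C' ⪯ cov k` with a MARGIN `√C' D_k √C' ⪯ θ·1`, `θ < 1`, on the dominating
sequence.  For the multiplier tower of `WeightData.dominated_of_multipliers`
(`cov k = mulMat((1+θ̄)c_{k+1})`, `D_k = mulMat d_k`, `d_k = (λm_k⁻¹ + (1+θ_k)t_k)⁻¹`,
`t_k = c_{k+1} + t_{k+1}`) and the true step covariance `C' = mulMat c_{k+1}` (in [ABKM19]:
`𝒞_{k+1} = (1+θ̄)⁻¹ · ((1+θ̄)𝒞_{k+1})`) the margin is AUTOMATIC with `θ = (1+θ̄)⁻¹`: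
`c_{k+1} d_k ≤ c_{k+1}/((1+θ_k)t_k) ≤ (1+θ_k)⁻¹ ≤ (1+θ̄)⁻¹ < 1` ([ABKM19] (7.71) with `ρ = 0`:
"`(1+ρ)𝒞^{1/2} A_k^X 𝒞^{1/2} ≤ (1+ρ)²/(1+θ̄) < 1`").

* `domMul_neg` (evenness of `d_k`), `cov_mul_domMul_le` (the scalar margin);
* **`WeightData.integral_weight_add_le_of_multipliers`** — (w7) against `N(0, mulMat c_{k+1})`
  with `θ = (1+θ̄)⁻¹`, the trace of `√C' A_k^X √C'` left in the exponent (Lemma 7.7 (i) bounds it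
  by `c|X|_k`).

Everything is proved; no named fact.

## References
* S. Adams, S. Buchholz, R. Kotecký, S. Müller, arXiv:1910.13564, Lemma 7.7, (7.71), (7.82),
  Theorem 7.1 (w7) [AdamsBuchholzKoteckyMuller2019].
-/

noncomputable section

namespace Literature.MathematicalPhysics.StatisticalMechanics.GradientRG

open Finset Matrix MeasureTheory ProbabilityTheory WithLp
open scoped MatrixOrder
open Literature.MathematicalPhysics.StatisticalMechanics.GradientFRD
  (mulMat mulMat_smul posSemidef_mulMat posSemidef_mulMat_sub
    posSemidef_smul_one_sub_sqrt_mul_mul_sqrt_mulMat)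

variable {d M : ℕ} [NeZero M]

omit [NeZero M] in
/-- The dominating multipliers are even when `m_k`, `t_k` are.
[cite: AdamsBuchholzKoteckyMuller2019, Lemma 7.5 (v) (7.30)] -/
theorem domMul_neg {lam : ℝ} {θ : ℕ → ℝ} {m t : ℕ → (Fin d → ZMod M) → ℝ}
    (hm : ∀ k κ, m k (-κ) = m k κ) (ht : ∀ k κ, t k (-κ) = t k κ) (k : ℕ) (κ : Fin d → ZMod M) :
    domMul lam θ m t k (-κ) = domMul lam θ m t k κ := by
  simp only [domMul, hm, ht]

/-- **The scalar margin** ([ABKM19] (7.71) at `ρ = 0`): with `d = (λm⁻¹ + (1+θ)t)⁻¹`,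
`t = c + t'`, `c, t', λ, m ≥ 0` and `1 + θ > 0`: `c · d ≤ (1+θ)⁻¹`.
[cite: AdamsBuchholzKoteckyMuller2019, Lemma 7.7 (7.71)] -/
theorem cov_mul_domScalar_le {lam θ m c t' : ℝ} (hlam : 0 ≤ lam) (hm : 0 ≤ m) (hθ : 0 < 1 + θ)
    (hc : 0 ≤ c) (ht' : 0 ≤ t') : c * domScalar lam θ m (c + t') ≤ (1 + θ)⁻¹ := by
  unfold domScalar
  by_cases hc0 : c = 0
  · rw [hc0, zero_mul]; exact inv_nonneg.2 hθ.le
  have hcpos : 0 < c := lt_of_le_of_ne hc (Ne.symm hc0)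
  have hP : (1 + θ) * c ≤ lam * m⁻¹ + (1 + θ) * (c + t') := by
    have : 0 ≤ lam * m⁻¹ := mul_nonneg hlam (inv_nonneg.2 hm)
    nlinarith
  have hPpos : 0 < lam * m⁻¹ + (1 + θ) * (c + t') := lt_of_lt_of_le (by positivity) hP
  rw [← div_eq_mul_inv, div_le_iff₀ hPpos, ← div_eq_inv_mul, le_div_iff₀ hθ]
  linarith

namespace WeightData

/-- **Theorem 7.1 (w7) against the true step covariance, for the multiplier tower**: if
`W.Dominated (k ↦ mulMat d_k)` with `d_k = domMul λ θ m t k`, `W.cov k = mulMat((1+θ̄)c_{k+1})`,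
`t_k = c_{k+1} + t_{k+1}`, all multipliers even and non-negative, `0 < θ̄ ≤ θ_k`, `λ ≥ 0`, then
with `θ = (1+θ̄)⁻¹`, for every set `X` and field `φ`:
`∫ w_k^X(φ + ψ) N(0, mulMat c_{k+1})(dψ) ≤ (1−θ)^{−tr(√C A_k^X √C)/(2θ)} · w_{k:k+1}^X(φ)`,
`C = mulMat c_{k+1}`. [cite: AdamsBuchholzKoteckyMuller2019, Theorem 7.1 (w7)] -/
theorem integral_weight_add_le_of_multipliers (W : WeightData (Fin d → ZMod M)) {lam θbar : ℝ}
    {θ : ℕ → ℝ} {m c t : ℕ → (Fin d → ZMod M) → ℝ}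
    (hD : W.Dominated fun k => mulMat (domMul lam θ m t k)) {k : ℕ}
    (hcov : W.cov k = mulMat fun κ => (1 + θbar) * c (k + 1) κ)
    (hθbar : 0 < θbar) (hθ : θbar ≤ θ k) (hlam : 0 ≤ lam)
    (hm_even : ∀ k κ, m k (-κ) = m k κ) (hm_nonneg : ∀ κ, 0 ≤ m k κ)
    (hc_even : ∀ κ, c (k + 1) (-κ) = c (k + 1) κ) (hc_nonneg : ∀ κ, 0 ≤ c (k + 1) κ)
    (ht_even : ∀ k κ, t k (-κ) = t k κ) (ht : ∀ κ, t k κ = c (k + 1) κ + t (k + 1) κ)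
    (ht_nonneg : ∀ κ, 0 ≤ t (k + 1) κ) (X : Finset (Fin d → ZMod M)) (φ : (Fin d → ZMod M) → ℝ) :
    ∫ ψ, W.weight k X (φ + ofLp ψ) ∂(multivariateGaussian 0 (mulMat (c (k + 1)))) ≤
      (1 - (1 + θbar)⁻¹) ^ (-((CFC.sqrt (mulMat (c (k + 1))) * W.form k X *
          CFC.sqrt (mulMat (c (k + 1)))).trace / (2 * (1 + θbar)⁻¹))) * W.midWeight k X φ := by
  have hθk : 0 < 1 + θ k := by linarith
  refine integral_weight_add_le_of_cov_le hD (posSemidef_mulMat hc_nonneg) ?_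
    (inv_pos.2 (by linarith)) (inv_lt_one_of_one_lt₀ (by linarith)) ?_ X φ
  · -- `cov k − C' = mulMat(θ̄ c) ⪰ 0`
    rw [hcov]
    exact posSemidef_mulMat_sub fun κ => by nlinarith [hc_nonneg κ]
  · -- the margin `c_{k+1} d_k ≤ (1+θ_k)⁻¹ ≤ (1+θ̄)⁻¹` on every mode
    refine posSemidef_smul_one_sub_sqrt_mul_mul_sqrt_mulMat (domMul_neg hm_even ht_even k) hc_even
      hc_nonneg fun κ => ?_
    show c (k + 1) κ * domMul lam θ m t k κ ≤ (1 + θbar)⁻¹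
    rw [domMul, ht κ]
    exact (cov_mul_domScalar_le hlam (hm_nonneg κ) hθk (hc_nonneg κ) (ht_nonneg κ)).trans
      (inv_anti₀ (by linarith) (by linarith))

end WeightData

end Literature.MathematicalPhysics.StatisticalMechanics.GradientRG

end
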